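import Summits.AnomalousDissipation.AnomalousDissipation.Theorems.MarginalStabilityChainStrainedLayerLawClockEnergyRelaminarisationToolsC
import Mathlib.MeasureTheory.Integral.IntervalIntegral.FundThmCalculus
import HarnessLib

/-!
# Crux `MarginalStabilityChain.StrainedLayerLaw` (stmt-AnomalousDissipation-3007), line `FirstLemmasR2K4`
# (log-enstrophy clock + Nash roundness): GLOBAL NONLINEAR ENERGY STABILITY of the Burgers layer in the tailed class

Support file (`--supports stmt-AnomalousDissipation-3007`) proving the registered sub-goal `energy_relaminarisation` of
line `FirstLemmasR2K4` (lead c7) BY NAME: for `0 < ν`, `0 < L` with `L²(3πν + 2) ≤ 16π³ν²`, every classical solution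
`(u, v, p)` of the stretched shear-layer system (`γ = ΔU = 1`, period `L`) on `(0, ∞)` with uniform exponential shear
tails on compact windows relaxes to the laminar Burgers layer `U_B = burgersLayerProfile 1 ν 1` exponentially IN ENERGY:
with `W(τ) = ∫∫_{(0,L]×ℝ} ((u − U_B)² + v²)` and `‖∇w‖²(τ) = ∫∫ ((∂ₓu)² + (∂_yu − U_B′)² + (∂ₓv)² + (∂_yv)²)`,

  `W(t) ≤ e^{−(t−s)/2} W(s)`  and  `ν∫_s^t ‖∇w‖² ≤ (3/2 + 1/(πν)) W(s)`   (`0 < s ≤ t`).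

This is the energy method of Serrin (1959) / Joseph (1976) for the strained shear layer (the nonlinear, global
companion of the route's linear low-Reynolds-number stability; tool files A–C are
`…ClockEnergyRelaminarisationToolsA/B/C.lean`): by the exact identity of tool file B (`energyRelam_identity`)
`½W′ = −∫∫ abU_B′ − ½‖a‖² + ½‖b‖² − ν‖∇w‖²` (`a = u − U_B`, `b = v`); then
`−abU_B′ ≤ ¼a² + U_B′²b² ≤ ¼a² + b²/(2πν)` pointwise (`U_B′² ≤ 1/(2πν)`), Wirtinger on every line for `b` (zero
period mean, `energyRelam_wirtinger_strip`) `‖b‖² ≤ (L/2π)²‖∂ₓb‖² ≤ (L/2π)²‖∇w‖²`, and the hypothesis in the form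
`4π²ν/L² ≥ ¾ + 1/(2πν)` give `W′ ≤ −½W` and `2ν‖∇w‖² ≤ −W′ + (1 + 1/(πν))W` (`energyRelam_estimate`); Grönwall
(`e^{τ/2}W` is nonincreasing) and integration in time (`W` is `C¹` by differentiation under the integral sign,
`‖∇w‖²` continuous by dominated convergence) finish. Consequence (neighbour stub
`meanLayerDissipation_laminar_of_energyDecay`): below the energy-stability threshold every tailed member has the
laminar mean dissipation `√ν/(2√π)`, so the crux's `ν₀(L)` must lie below `ν_E(L)` — its quantifier order `∀L ∃ν₀`
is forced.

References: J. Serrin, *On the stability of viscous fluid motions*, Arch. Rational Mech. Anal. 3 (1959) 1–13;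
D. D. Joseph, *Stability of Fluid Motions I*, Springer 1976, §2–§4; A. J. Majda, A. L. Bertozzi, *Vorticity and
Incompressible Flow*, CUP 2002, §3.1.1; G. H. Hardy, J. E. Littlewood, G. Pólya, *Inequalities*, CUP 1952, §7.7.
-/

-- `Summit.<Summit>.<Problem>` is the tree's mandated summit-side namespace (CONVENTIONS §2); for this
-- single-conjunct summit the two coincide, so the duplicate is deliberate.
set_option linter.dupNamespace false

noncomputable section

open scoped Topology ENNReal
open Filter Set Function MeasureTheory

namespace Summit.AnomalousDissipation.AnomalousDissipation.Theorems.StrainedLayerLaw.LogEnstrophyClock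

open Literature.Analysis.FluidPDE Literature.Analysis.FluidPDE.StretchedLayer
open Summit.AnomalousDissipation.AnomalousDissipation.Theses.MarginalStabilityChain
open Summit.AnomalousDissipation.AnomalousDissipation.Theorems.StrainedLayerLaw.StrainWorkSumRule

/-! ## The registered stub -/

/-- **Registered stub `energy_relaminarisation` of line `FirstLemmasR2K4` (crux `StrainedLayerLaw`,
stmt-AnomalousDissipation-3007): GLOBAL NONLINEAR ENERGY STABILITY OF THE BURGERS LAYER IN THE TAILED CLASS AT LOW
REYNOLDS NUMBER.** For `0 < ν`, `0 < L` with `L²(3πν + 2) ≤ 16π³ν²`, every classical solution of the stretched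
shear-layer system (`γ = ΔU = 1`, period `L`) on `(0, ∞)` with uniform exponential shear tails on compact windows
satisfies, for `0 < s ≤ t`, with `U_B = burgersLayerProfile 1 ν 1`, `U_B′ = burgersLayerProfileD 1 ν 1` and
`W(τ) = ∫_{x∈(0,L]}∫_y ((u − U_B)² + v²)`:
`W(t) ≤ e^{−(t−s)/2} W(s)` and `ν∫_s^t ∫∫((∂ₓu)² + (∂_yu − U_B′)² + (∂ₓv)² + (∂_yv)²) ≤ (3/2 + 1/(πν)) W(s)`.
The energy method of Serrin / Joseph for the strained layer: the exact identity
`½W′ = −∫∫abU_B′ − ½‖a‖² + ½‖b‖² − ν‖∇w‖²` (`energyRelam_identity`), `|U_B′| ≤ 1/√(2πν)`, Wirtinger for `b = v`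
on every line, whence `W′ ≤ −½W` and `2ν‖∇w‖² ≤ −W′ + (1 + 1/(πν))W` (`energyRelam_estimate`); Grönwall
(`e^{τ/2}W(τ)` nonincreasing) and `∫_s^t W ≤ 2W(s)`. Hence (neighbour stub) every tailed member below the
energy-stability threshold has the LAMINAR mean dissipation `√ν/(2√π)`: the crux's `ν₀(L)` must lie below `ν_E(L)`.
[folklore] -/
theorem energy_relaminarisation : ∀ (ν L : ℝ), 0 < ν → 0 < L →
    L ^ 2 * (3 * Real.pi * ν + 2) ≤ 16 * Real.pi ^ 3 * ν ^ 2 → ∀ (u v p : ℝ → ℝ → ℝ → ℝ),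
    IsStretchedLayerNSSolutionOn (Ioi 0) ν 1 1 L u v p → (∀ a b : ℝ, 0 < a → a < b → ExpTails (Icc a b) u v) →
    ∀ s t : ℝ, 0 < s → s ≤ t →
      (∫ x in Ioc 0 L, ∫ y, ((u t x y - burgersLayerProfile 1 ν 1 y) ^ 2 + v t x y ^ 2)) ≤
        Real.exp (-(t - s) / 2) * (∫ x in Ioc 0 L, ∫ y, ((u s x y - burgersLayerProfile 1 ν 1 y) ^ 2 + v s x y ^ 2)) ∧
      ν * (∫ τ in s..t, ∫ x in Ioc 0 L, ∫ y, (dX (u τ) x y ^ 2 + (dY (u τ) x y - burgersLayerProfileD 1 ν 1 y) ^ 2 +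
        dX (v τ) x y ^ 2 + dY (v τ) x y ^ 2)) ≤
        (3 / 2 + 1 / (Real.pi * ν)) * ∫ x in Ioc 0 L, ∫ y, ((u s x y - burgersLayerProfile 1 ν 1 y) ^ 2 + v s x y ^ 2) := by
  intro ν L hν hL hνL u v p h htails s t hs hst
  -- uniform tails on the window `[s/2, t+1] ⊃ [s, t]`
  obtain ⟨C, k, hk, hCk⟩ := htails (s / 2) (t + 1) (by linarith) (by linarith)
  have hpos : ∀ {σ : ℝ}, σ ∈ Icc (s / 2) (t + 1) → 0 < σ := fun hσ => by linarith [hσ.1]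
  have hwin : ∀ {σ : ℝ}, σ ∈ Icc s t → σ ∈ Ioo (s / 2) (t + 1) := fun hσ => ⟨by linarith [hσ.1], by linarith [hσ.2]⟩
  have hST : ∀ σ ∈ Icc (s / 2) (t + 1), SliceTails C k (u σ) (v σ) := fun σ hσ => (hCk σ hσ).1
  have hTd : ∀ σ ∈ Icc (s / 2) (t + 1), ∀ x y, |deriv (fun r => u r x y) σ| + |deriv (fun r => v r x y) σ| ≤
      C * Real.exp (-k * |y|) := by
    intro σ hσ x y
    have h1 := (hCk σ hσ).2 x y
    rwa [dT_of_isOpen isOpen_Ioi u (mem_Ioi.2 (hpos hσ)), dT_of_isOpen isOpen_Ioi v (mem_Ioi.2 (hpos hσ))] at h1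
  set UB := burgersLayerProfile 1 ν 1 with hUB_def
  set UB' := burgersLayerProfileD 1 ν 1 with hUB'_def
  -- the strip functionals
  set W : ℝ → ℝ := fun σ => ∫ q in Ioc 0 L ×ˢ univ, ((u σ q.1 q.2 - UB q.2) ^ 2 + v σ q.1 q.2 ^ 2) with hW_def
  set I : ℝ → ℝ := fun σ => ∫ q in Ioc 0 L ×ˢ univ, ((u σ q.1 q.2 - UB q.2) * deriv (fun r => u r q.1 q.2) σ +
    v σ q.1 q.2 * deriv (fun r => v r q.1 q.2) σ) with hI_def
  set G : ℝ → ℝ := fun σ => ∫ q in Ioc 0 L ×ˢ univ, (dX (u σ) q.1 q.2 ^ 2 + (dY (u σ) q.1 q.2 - UB' q.2) ^ 2 +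
    dX (v σ) q.1 q.2 ^ 2 + dY (v σ) q.1 q.2 ^ 2) with hG_def
  have hS : MeasurableSet (Ioc (0:ℝ) L ×ˢ (univ : Set ℝ)) := measurableSet_Ioc.prod MeasurableSet.univ
  have hW0 : ∀ σ, 0 ≤ W σ := fun σ => setIntegral_nonneg hS fun q _ => by positivity
  have hG0 : ∀ σ, 0 ≤ G σ := fun σ => setIntegral_nonneg hS fun q _ => by positivity
  -- derivative of `W`, the two energy inequalities, continuity
  have hder : ∀ σ ∈ Ioo (s / 2) (t + 1), HasDerivAt W (2 * I σ) σ := fun σ hσ =>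
    energyRelam_hasDerivAt hν hL (by linarith) hk h hST hTd hσ
  have hest : ∀ σ ∈ Ioo (s / 2) (t + 1), 2 * I σ ≤ -(1 / 2) * W σ ∧
      2 * (ν * G σ) ≤ -(2 * I σ) + (1 + 1 / (Real.pi * ν)) * W σ := fun σ hσ =>
    energyRelam_estimate hν hL (hpos (Ioo_subset_Icc_self hσ)) hk hνL h (hST σ (Ioo_subset_Icc_self hσ))
      (hTd σ (Ioo_subset_Icc_self hσ))
  have hWc : ContinuousOn W (Icc s t) := fun σ hσ => (hder σ (hwin hσ)).continuousAt.continuousWithinAt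
  have hGc : ContinuousOn G (Icc s t) :=
    (energyRelam_continuousOn_gradient ν L (s / 2) (t + 1) C k u v p hν (by linarith) hk h hST).mono
      (Icc_subset_Icc (by linarith) (by linarith))
  have hsI : s ∈ Icc s t := left_mem_Icc.2 hst
  -- (1) `e^{σ/2} W(σ)` is nonincreasing on `[s, t]`
  have hdecay : ∀ σ ∈ Icc s t, W σ ≤ Real.exp (-(σ - s) / 2) * W s := by
    have hg : ∀ σ ∈ Ioo (s / 2) (t + 1), HasDerivAt (fun σ => Real.exp (σ / 2) * W σ)
        (Real.exp (σ / 2) * (1 / 2) * W σ + Real.exp (σ / 2) * (2 * I σ)) σ := fun σ hσ =>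
      ((hasDerivAt_id' σ).div_const 2).exp.fun_mul (hder σ hσ)
    have hanti : AntitoneOn (fun σ => Real.exp (σ / 2) * W σ) (Icc s t) := by
      refine antitoneOn_of_hasDerivWithinAt_nonpos (convex_Icc s t)
        (f' := fun σ => Real.exp (σ / 2) * (1 / 2) * W σ + Real.exp (σ / 2) * (2 * I σ))
        ((Real.continuous_exp.comp (continuous_id.div_const 2)).continuousOn.mul hWc) ?_ ?_
      · rw [interior_Icc]
        exact fun σ hσ => (hg σ (hwin (Ioo_subset_Icc_self hσ))).hasDerivWithinAt
      · rw [interior_Icc]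
        intro σ hσ
        have h1 := (hest σ (hwin (Ioo_subset_Icc_self hσ))).1
        have h2 := hW0 σ
        have h3 := Real.exp_pos (σ / 2)
        nlinarith
    intro σ hσ
    have h1 : Real.exp (σ / 2) * W σ ≤ Real.exp (s / 2) * W s := hanti hsI hσ hσ.1
    have h2 : Real.exp (-(σ - s) / 2) * W s = Real.exp (-(σ / 2)) * (Real.exp (s / 2) * W s) := by
      rw [← mul_assoc, ← Real.exp_add]; congr 1; ring
    have h3 : W σ = Real.exp (-(σ / 2)) * (Real.exp (σ / 2) * W σ) := by
      rw [← mul_assoc, ← Real.exp_add, show -(σ / 2) + σ / 2 = 0 by ring, Real.exp_zero, one_mul]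
    rw [h2, h3]
    exact mul_le_mul_of_nonneg_left h1 (Real.exp_pos _).le
  -- (2) the gradient budget: integrate `2νG − (1 + 1/(πν))W ≤ −W′` over `[s, t]`
  have hbudget : ν * ∫ τ in s..t, G τ ≤ (3 / 2 + 1 / (Real.pi * ν)) * W s := by
    have hc₁0 : 0 ≤ 1 + 1 / (Real.pi * ν) := by positivity
    have hφc : ContinuousOn (fun τ => 2 * (ν * G τ) - (1 + 1 / (Real.pi * ν)) * W τ) (Icc s t) :=
      (continuousOn_const.mul (continuousOn_const.mul hGc)).sub (continuousOn_const.mul hWc)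
    have hFTC := intervalIntegral.integral_le_sub_of_hasDeriv_right_of_le hst hWc.neg
      (fun τ hτ => ((hder τ (hwin (Ioo_subset_Icc_self hτ))).neg).hasDerivWithinAt)
      (hφc.integrableOn_Icc) (fun τ hτ => by
        have := (hest τ (hwin (Ioo_subset_Icc_self hτ))).2
        show 2 * (ν * G τ) - (1 + 1 / (Real.pi * ν)) * W τ ≤ -(2 * I τ)
        linarith)
    have hGi : IntervalIntegrable G volume s t := hGc.intervalIntegrable_of_Icc hst
    have hWi : IntervalIntegrable W volume s t := hWc.intervalIntegrable_of_Icc hst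
    rw [intervalIntegral.integral_sub ((hGi.const_mul ν).const_mul 2) (hWi.const_mul _),
      intervalIntegral.integral_const_mul, intervalIntegral.integral_const_mul,
      intervalIntegral.integral_const_mul] at hFTC
    simp only [Pi.neg_apply] at hFTC
    -- `∫_s^t W ≤ 2 W(s)`
    have hexp : ∀ τ, HasDerivAt (fun τ => -2 * Real.exp (-(τ - s) / 2)) (Real.exp (-(τ - s) / 2)) τ := fun τ => by
      have h1 := ((((hasDerivAt_id' τ).sub_const s).fun_neg).div_const 2).exp.const_mul (-2)
      refine h1.congr_deriv ?_
      ring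
    have hexpI : ∫ τ in s..t, Real.exp (-(τ - s) / 2) = -2 * Real.exp (-(t - s) / 2) - -2 * Real.exp (-(s - s) / 2) :=
      intervalIntegral.integral_eq_sub_of_hasDerivAt (fun τ _ => hexp τ)
        ((Real.continuous_exp.comp ((continuous_id.sub continuous_const).neg.div_const 2)).intervalIntegrable _ _)
    have hWint : ∫ τ in s..t, W τ ≤ 2 * W s := by
      have h1 : ∫ τ in s..t, W τ ≤ ∫ τ in s..t, Real.exp (-(τ - s) / 2) * W s :=
        intervalIntegral.integral_mono_on hst hWi
          (((Real.continuous_exp.comp ((continuous_id.sub continuous_const).neg.div_const 2)).mul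
            continuous_const).intervalIntegrable _ _)
          fun τ hτ => hdecay τ hτ
      rw [intervalIntegral.integral_mul_const, hexpI, sub_self, neg_zero, zero_div, Real.exp_zero] at h1
      have h2 : 0 ≤ Real.exp (-(t - s) / 2) := (Real.exp_pos _).le
      nlinarith [hW0 s]
    have h4 := mul_le_mul_of_nonneg_left hWint hc₁0
    have h5 := hW0 t
    linarith
  -- (3) bridges to the line's iterated integrals
  have hWit : ∀ σ ∈ Icc (s / 2) (t + 1),
      (∫ x in Ioc 0 L, ∫ y, ((u σ x y - UB y) ^ 2 + v σ x y ^ 2)) = W σ := fun σ hσ =>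
    integral_iterated_eq_strip (energyRelam_identity ν L σ C k u v p hν hL (hpos hσ) hk h (hST σ hσ) (hTd σ hσ)).1
  have hGit : ∀ σ ∈ Icc (s / 2) (t + 1), (∫ x in Ioc 0 L, ∫ y, (dX (u σ) x y ^ 2 + (dY (u σ) x y - UB' y) ^ 2 +
      dX (v σ) x y ^ 2 + dY (v σ) x y ^ 2)) = G σ := fun σ hσ =>
    integral_iterated_eq_strip
      (energyRelam_identity ν L σ C k u v p hν hL (hpos hσ) hk h (hST σ hσ) (hTd σ hσ)).2.2.2.2.1
  have hGint : ∫ τ in s..t, (∫ x in Ioc 0 L, ∫ y, (dX (u τ) x y ^ 2 + (dY (u τ) x y - UB' y) ^ 2 +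
      dX (v τ) x y ^ 2 + dY (v τ) x y ^ 2)) = ∫ τ in s..t, G τ :=
    intervalIntegral.integral_congr fun τ hτ => hGit τ (Ioo_subset_Icc_self (hwin (by rwa [uIcc_of_le hst] at hτ)))
  rw [hWit t (Ioo_subset_Icc_self (hwin (right_mem_Icc.2 hst))), hWit s (Ioo_subset_Icc_self (hwin hsI)), hGint]
  exact ⟨hdecay t (right_mem_Icc.2 hst), hbudget⟩

end Summit.AnomalousDissipation.AnomalousDissipation.Theorems.StrainedLayerLaw.LogEnstrophyClock

end
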